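import Summits.QuantumFields.YangMills.Theorems.AllWindowsColdBoxBoxHighLineStep2Wick
import Summits.QuantumFields.YangMills.Theorems.AllWindowsColdBoxBoxHighLineEdgeChartSupport
import Summits.QuantumFields.YangMills.Theorems.AllWindowsColdBoxBoxHighLineSmearedFPOperatorExpansion
import Summits.QuantumFields.YangMills.Theorems.AllWindowsColdBoxBoxHighLineHaarDensityFlat

/-!
# T-S5.7b `phiTaylor : PhiTaylor` BY NAME — the gauge-fixing functional `Φ` in the edge chart: exact parity, global quartic bound, sextic Taylor
# remainder (STUB-PLAN-S5-STEP2 §3/§8, task file ✓`…Theorems.AllWindowsColdBoxBoxHighLineStep2Wick`; LINE-19 S5 ⟨stmt-QuantumFields-24004⟩/⟨24335⟩)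

Width seat `ym-line-sfw-p2-w3` (g40, cell `ym-idea-1`), routed by planner ym-idea-2 g18 (2026-08-29T19:07:07Z «w3: T-S5.7b/7e»).

**Theorem (`phiTaylor`, constant `C = 3072`).**  For every `H ≥ 1` and every edge field `a : LandauFree H → ℝ³`, with `U(a) = edgeChart H a`:
1. `Φ(U(−a)) = Φ(U(a))` (exact parity);
2. `|Φ(U(a)) − Σ_{x interior} |(d*a)_x|²| ≤ C · Σ_x (Σ_e |g_x e| ‖a_e‖²)²` for ALL fields (no smallness);
3. if all `‖a_e‖ ≤ t ≤ 1`: `|Φ(U(a)) − Σ_x |(d*a)_x|² − phiQuartic H a| ≤ C · H⁴ · t⁶`.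

Proof.  In the chart every box link is `expPauli a_e`, and by Euler's formula (✓`coe_expPauli_eq`) and the dictionary ✓`imVecM_su2Coord` its
su(2)-coordinates are `imVec (expPauli v) = sinc‖v‖ · (v₂, −v₁, v₀)` (`imVec_expPauli`) — a signed permutation of the colours times `sinc`.  Hence
(✓`landauPhi_eq_sum_gradVec_sq`) `Φ(U(a)) = Σ_x Σ_c (g_x · (sinc‖a_e‖ a_e^c)_e)²` (`landauPhi_edgeChart_eq`), which is manifestly even in `a`.
At an interior site `g_x · f = Σ_μ f(x−e_μ, μ) − Σ_μ f(x, μ)` (✓`gradVec_dotProduct_eq_interior`), so each divergence is a plain sum over the EIGHT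
signed edge variables `u = (a_{in μ}, −a_{out μ})` of an odd function, and `Σ_k ‖u_k‖² = Σ_e |g_x e| ‖a_e‖²` (`sum_norm_sq_signed`).  For a finite family
`u_k` (generic lemmas `quartic_core` / `sextic_core`):
* `(Σ s_k u_k^c)² − (Σ u_k^c)² = Σ_{k,l} u_k^c u_l^c (s_k s_l − 1)` with `|s_k s_l − 1| ≤ (r_k² + r_l²)/6` (✓`abs_sinc_sub_one_le` for ALL `r ≥ 0`,
  `|sinc| ≤ 1`) and `r_k r_l (r_k² + r_l²) ≤ r_k⁴ + r_l⁴`, so the colour sum is `≤ n Σ r_k⁴ ≤ n (Σ r_k²)²` (`n = 8`): clause 2 with `8 ≤ C`;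
* `sinc r = 1 − r²/6 + ρ(r)`, `|ρ| ≤ r⁴/100` on `[0,1]` (w5's ✓`abs_sin_div_sub_le`), so `S = L − K/6 + R` with `|L| ≤ nt`, `|K| ≤ nt³`, `|R| ≤ nt⁵/100`
  and `S² − L² + (1/3)LK = 2LR + (R − K/6)² ≤ n²t⁶`; `phiQuartic = −(1/3) Σ_x Σ_c L·K`; summing over `3` colours and `≤ 16H⁴` interior sites gives
  clause 3 with `C = 3 · 64 · 16 = 3072`.

Everything proved, Mathlib + tree only, standard axioms; no definitions.
HONEST LABEL: an S-sized brick of STEP 2 of the XL stub S5 (`stub_landauSecondOrder`) of a critic-PASSed DRAFT line; S5, U5, ⟨24004⟩ ⟨24335⟩ ⟨24336⟩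
remain OPEN; no stub is closed by name, no crux, rung or summit is proved; **the Yang–Mills mass gap is NOT proved by this file.**
-/

set_option autoImplicit false

noncomputable section

open MeasureTheory Matrix Finset Real
open Literature.Probability.LatticeModels (Site)
open Literature.MathematicalPhysics.QuantumFieldTheory.Balaban1983to89.B10Eq18SigmaSU2 (su2Coord)
open Literature.MathematicalPhysics.QuantumFieldTheory.Balaban1983to89.B10Eq18SigmaSU2Haar (expPauli)
open Literature.MathematicalPhysics.QuantumLattice (ZdEdge LGConfig)

namespace Summit.QuantumFields.YangMills.Theorems.AllWindowsColdBoxBoxHighLine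

namespace PhiTaylorProof

/-! ## Scalar facts about `sinc` -/

/-- `|sinc r − 1 + r²/6| ≤ r⁴/100` on `[0, 1]` (✓`abs_sin_div_sub_le`). -/
theorem abs_sinc_taylor_four {r : ℝ} (h0 : 0 ≤ r) (h1 : r ≤ 1) : |Real.sinc r - 1 + r ^ 2 / 6| ≤ r ^ 4 / 100 := by
  rcases eq_or_lt_of_le h0 with h | h
  · rw [← h]; simp
  · have habs : |r| ≤ 1 := by rw [abs_of_nonneg h0]; exact h1
    have := abs_sin_div_sub_le habs h.ne'
    rw [Real.sinc_of_ne_zero h.ne']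
    have e : Real.sin r / r - 1 + r ^ 2 / 6 = Real.sin r / r - (1 - r ^ 2 / 6) := by ring
    rw [e]; exact this

/-- `|sinc r · sinc r' − 1| ≤ (r² + r'²)/6` for `r, r' ≥ 0` (✓`abs_sinc_sub_one_le`, `|sinc| ≤ 1`). -/
theorem abs_sinc_mul_sinc_sub_one_le {r r' : ℝ} (hr : 0 ≤ r) (hr' : 0 ≤ r') :
    |Real.sinc r * Real.sinc r' - 1| ≤ (r ^ 2 + r' ^ 2) / 6 := by
  have h1 := abs_sinc_sub_one_le hr
  have h2 := abs_sinc_sub_one_le hr'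
  have h3 := Real.abs_sinc_le_one r'
  have e : Real.sinc r * Real.sinc r' - 1 = (Real.sinc r - 1) * Real.sinc r' + (Real.sinc r' - 1) := by ring
  rw [e]
  calc |(Real.sinc r - 1) * Real.sinc r' + (Real.sinc r' - 1)|
      ≤ |(Real.sinc r - 1) * Real.sinc r'| + |Real.sinc r' - 1| := abs_add_le _ _
    _ = |Real.sinc r - 1| * |Real.sinc r'| + |Real.sinc r' - 1| := by rw [abs_mul]
    _ ≤ r ^ 2 / 6 * 1 + r' ^ 2 / 6 := by
        have := mul_le_mul h1 h3 (abs_nonneg _) (by positivity)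
        linarith
    _ = (r ^ 2 + r' ^ 2) / 6 := by ring

/-! ## The su(2)-coordinates of the chart point: `imVec (expPauli v) = sinc‖v‖ · (v₂, −v₁, v₀)` -/

/-- **`imVec (expPauli v) = sinc ‖v‖ • (pauliPerm v)`** (Euler ✓`coe_expPauli_eq` + dictionary ✓`imVecM_su2Coord`). -/
theorem imVec_expPauli (v : E3) : imVec (expPauli v) = Real.sinc ‖v‖ • (pauliPerm *ᵥ ⇑v) := by
  -- a real scalar acting through `ℂ` on a complex matrix acts as the real scalar
  have hsmul : ∀ (r : ℝ) (X : Matrix (Fin 2) (Fin 2) ℂ), (r : ℂ) • X = r • X := fun r X => by ext i j; simp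
  rw [imVec_eq_imVecM, coe_expPauli_eq, imVecM_add, hsmul, hsmul, imVecM_smul, imVecM_smul, imVecM_one,
    smul_zero, zero_add, imVecM_su2Coord]

/-- Componentwise: `imVec (expPauli v) c = sinc ‖v‖ · (v₂, −v₁, v₀)_c`. -/
theorem imVec_expPauli_apply (v : E3) (c : Fin 3) :
    imVec (expPauli v) c = Real.sinc ‖v‖ * (![v 2, -v 1, v 0] : Fin 3 → ℝ) c := by
  rw [imVec_expPauli, Pi.smul_apply, smul_eq_mul]
  congr 1
  fin_cases c <;> simp [pauliPerm, Matrix.mulVec, dotProduct, Fin.sum_univ_three]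

/-! ## `Φ` in the chart as a `sinc`-weighted divergence energy; exact parity -/

/-- **`Φ(U(a)) = Σ_x Σ_c (g_x · (sinc‖a_e‖ a_e^c)_e)²`** (the signed permutation of colours drops out of the sum of squares). -/
theorem landauPhi_edgeChart_eq (H : ℕ) (a : LandauFree H → E3) :
    landauPhi H (edgeChart H a) =
      ∑ x ∈ interiorSites H, ∑ c : Fin 3, (gradVec H x ⬝ᵥ fun e : LandauFree H => Real.sinc ‖a e‖ * a e c) ^ 2 := by
  rw [landauPhi_eq_sum_gradVec_sq]
  refine Finset.sum_congr rfl fun x _ => ?_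
  have h : ∀ c, (gradVec H x ⬝ᵥ fun e : LandauFree H => imVec (edgeChart H a e.1.1) c) =
      gradVec H x ⬝ᵥ fun e : LandauFree H => Real.sinc ‖a e‖ * (![a e 2, -a e 1, a e 0] : Fin 3 → ℝ) c := by
    intro c
    congr 1; funext e
    rw [EdgeChart.edgeChart_apply_free, imVec_expPauli_apply]
  have hneg : (gradVec H x ⬝ᵥ fun e : LandauFree H => Real.sinc ‖a e‖ * -a e 1) =
      -(gradVec H x ⬝ᵥ fun e : LandauFree H => Real.sinc ‖a e‖ * a e 1) := by
    rw [← dotProduct_neg]; congr 1; funext e; simp [mul_neg]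
  simp only [h, Fin.sum_univ_three, Matrix.cons_val_zero, Matrix.cons_val_one, Matrix.cons_val_two, Matrix.head_cons,
    Matrix.tail_cons, hneg, neg_sq]
  ring

/-- **Exact parity**: `Φ(U(−a)) = Φ(U(a))`. -/
theorem landauPhi_edgeChart_neg (H : ℕ) (a : LandauFree H → E3) :
    landauPhi H (edgeChart H (-a)) = landauPhi H (edgeChart H a) := by
  rw [landauPhi_edgeChart_eq, landauPhi_edgeChart_eq]
  refine Finset.sum_congr rfl fun x _ => Finset.sum_congr rfl fun c _ => ?_
  have : (gradVec H x ⬝ᵥ fun e : LandauFree H => Real.sinc ‖(-a) e‖ * (-a) e c) =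
      -(gradVec H x ⬝ᵥ fun e : LandauFree H => Real.sinc ‖a e‖ * a e c) := by
    rw [← dotProduct_neg]; congr 1; funext e; simp [norm_neg, mul_neg]
  rw [this, neg_sq]

/-! ## Generic per-site algebra: a finite family of vectors `u_k ∈ ℝ³` (the eight signed edge variables at a site) -/

section Generic

variable {κ : Type*} [Fintype κ]

/-- `(Σ f)² − (Σ g)² = Σ_k Σ_l (f_k f_l − g_k g_l)`. -/
theorem sq_sum_sub_sq_sum (f g : κ → ℝ) :
    (∑ k, f k) ^ 2 - (∑ k, g k) ^ 2 = ∑ k, ∑ l, (f k * f l - g k * g l) := by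
  simp only [sq, Finset.sum_mul_sum, ← Finset.sum_sub_distrib]

/-- **Quartic core, one colour**: `|(Σ sinc‖u_k‖ u_k^c)² − (Σ u_k^c)²| ≤ (n/3) Σ ‖u_k‖⁴` (pairs: `|s_k s_l − 1| ≤ (r_k² + r_l²)/6` and
`r_k r_l (r_k² + r_l²) ≤ r_k⁴ + r_l⁴`). -/
theorem quartic_core (u : κ → E3) (c : Fin 3) :
    |(∑ k, Real.sinc ‖u k‖ * u k c) ^ 2 - (∑ k, u k c) ^ 2| ≤ (Fintype.card κ : ℝ) / 3 * ∑ k, ‖u k‖ ^ 4 := by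
  rw [sq_sum_sub_sq_sum]
  have hterm : ∀ k l, |Real.sinc ‖u k‖ * u k c * (Real.sinc ‖u l‖ * u l c) - u k c * u l c| ≤
      (‖u k‖ ^ 4 + ‖u l‖ ^ 4) / 6 := by
    intro k l
    have e : Real.sinc ‖u k‖ * u k c * (Real.sinc ‖u l‖ * u l c) - u k c * u l c =
        (u k c * u l c) * (Real.sinc ‖u k‖ * Real.sinc ‖u l‖ - 1) := by ring
    rw [e, abs_mul, abs_mul]
    have hk : |u k c| ≤ ‖u k‖ := by simpa only [Real.norm_eq_abs] using PiLp.norm_apply_le (u k) c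
    have hl : |u l c| ≤ ‖u l‖ := by simpa only [Real.norm_eq_abs] using PiLp.norm_apply_le (u l) c
    have hs := abs_sinc_mul_sinc_sub_one_le (norm_nonneg (u k)) (norm_nonneg (u l))
    have hkl : ‖u k‖ * ‖u l‖ * ((‖u k‖ ^ 2 + ‖u l‖ ^ 2) / 6) ≤ (‖u k‖ ^ 4 + ‖u l‖ ^ 4) / 6 := by
      nlinarith [sq_nonneg (‖u k‖ - ‖u l‖), norm_nonneg (u k), norm_nonneg (u l), sq_nonneg (‖u k‖ + ‖u l‖),
        mul_nonneg (norm_nonneg (u k)) (norm_nonneg (u l)), mul_nonneg (sq_nonneg (‖u k‖ - ‖u l‖)) (sq_nonneg (‖u k‖ + ‖u l‖))]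
    calc |u k c| * |u l c| * |Real.sinc ‖u k‖ * Real.sinc ‖u l‖ - 1|
        ≤ ‖u k‖ * ‖u l‖ * ((‖u k‖ ^ 2 + ‖u l‖ ^ 2) / 6) :=
          mul_le_mul (mul_le_mul hk hl (abs_nonneg _) (norm_nonneg _)) hs (abs_nonneg _) (by positivity)
      _ ≤ (‖u k‖ ^ 4 + ‖u l‖ ^ 4) / 6 := hkl
  have hsum : ∑ k : κ, ∑ l : κ, (‖u k‖ ^ 4 + ‖u l‖ ^ 4) / 6 = (Fintype.card κ : ℝ) / 3 * ∑ k, ‖u k‖ ^ 4 := by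
    have e1 : ∀ k : κ, ∑ l : κ, (‖u k‖ ^ 4 + ‖u l‖ ^ 4) / 6 =
        (Fintype.card κ : ℝ) * ‖u k‖ ^ 4 / 6 + (∑ l : κ, ‖u l‖ ^ 4) / 6 := by
      intro k
      rw [← Finset.sum_div, Finset.sum_add_distrib, Finset.sum_const, Finset.card_univ, nsmul_eq_mul, add_div]
    simp only [e1]
    rw [Finset.sum_add_distrib, Finset.sum_const, Finset.card_univ, nsmul_eq_mul, ← Finset.sum_div, ← Finset.mul_sum]
    ring
  calc |∑ k, ∑ l, (Real.sinc ‖u k‖ * u k c * (Real.sinc ‖u l‖ * u l c) - u k c * u l c)|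
      ≤ ∑ k, |∑ l, (Real.sinc ‖u k‖ * u k c * (Real.sinc ‖u l‖ * u l c) - u k c * u l c)| := Finset.abs_sum_le_sum_abs _ _
    _ ≤ ∑ k, ∑ l, |Real.sinc ‖u k‖ * u k c * (Real.sinc ‖u l‖ * u l c) - u k c * u l c| :=
        Finset.sum_le_sum fun k _ => Finset.abs_sum_le_sum_abs _ _
    _ ≤ ∑ k, ∑ l, (‖u k‖ ^ 4 + ‖u l‖ ^ 4) / 6 := Finset.sum_le_sum fun k _ => Finset.sum_le_sum fun l _ => hterm k l
    _ = (Fintype.card κ : ℝ) / 3 * ∑ k, ‖u k‖ ^ 4 := hsum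

/-- **Quartic core, three colours**: `|Σ_c ((Σ sinc‖u_k‖ u_k^c)² − (Σ u_k^c)²)| ≤ n · (Σ ‖u_k‖²)²`. -/
theorem quartic_site (u : κ → E3) :
    |∑ c : Fin 3, ((∑ k, Real.sinc ‖u k‖ * u k c) ^ 2 - (∑ k, u k c) ^ 2)| ≤
      (Fintype.card κ : ℝ) * (∑ k, ‖u k‖ ^ 2) ^ 2 := by
  have h4 : ∑ k, ‖u k‖ ^ 4 ≤ (∑ k, ‖u k‖ ^ 2) ^ 2 := by
    have := Finset.sum_sq_le_sq_sum_of_nonneg (s := Finset.univ) (f := fun k => ‖u k‖ ^ 2) (fun k _ => sq_nonneg _)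
    have e : ∀ k : κ, (‖u k‖ ^ 2) ^ 2 = ‖u k‖ ^ 4 := fun k => by ring
    simpa only [e] using this
  have hn : (0 : ℝ) ≤ Fintype.card κ := Nat.cast_nonneg _
  calc |∑ c : Fin 3, ((∑ k, Real.sinc ‖u k‖ * u k c) ^ 2 - (∑ k, u k c) ^ 2)|
      ≤ ∑ c : Fin 3, |(∑ k, Real.sinc ‖u k‖ * u k c) ^ 2 - (∑ k, u k c) ^ 2| := Finset.abs_sum_le_sum_abs _ _
    _ ≤ ∑ _c : Fin 3, (Fintype.card κ : ℝ) / 3 * ∑ k, ‖u k‖ ^ 4 := Finset.sum_le_sum fun c _ => quartic_core u c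
    _ = (Fintype.card κ : ℝ) * ∑ k, ‖u k‖ ^ 4 := by
        rw [Finset.sum_const, Finset.card_univ, Fintype.card_fin, nsmul_eq_mul]; push_cast; ring
    _ ≤ (Fintype.card κ : ℝ) * (∑ k, ‖u k‖ ^ 2) ^ 2 := mul_le_mul_of_nonneg_left h4 hn

/-- **Sextic core, one colour**: with all `‖u_k‖ ≤ t ≤ 1`,
`|(Σ sinc‖u_k‖ u_k^c)² − (Σ u_k^c)² + (1/3)(Σ u_k^c)(Σ ‖u_k‖² u_k^c)| ≤ n² t⁶`
(write `sinc r = 1 − r²/6 + ρ`, `|ρ| ≤ r⁴/100`: the square splits as `L² + 2LD + (2LR + (D+R)²)`, `D = −K/6`). -/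
theorem sextic_core (u : κ → E3) (c : Fin 3) {t : ℝ} (ht0 : 0 ≤ t) (ht1 : t ≤ 1) (hu : ∀ k, ‖u k‖ ≤ t) :
    |(∑ k, Real.sinc ‖u k‖ * u k c) ^ 2 - (∑ k, u k c) ^ 2 + 1 / 3 * (∑ k, u k c) * (∑ k, ‖u k‖ ^ 2 * u k c)| ≤
      (Fintype.card κ : ℝ) ^ 2 * t ^ 6 := by
  set n : ℝ := (Fintype.card κ : ℝ) with hn_def
  set L : ℝ := ∑ k, u k c with hL_def
  set K : ℝ := ∑ k, ‖u k‖ ^ 2 * u k c with hK_def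
  set R : ℝ := ∑ k, (Real.sinc ‖u k‖ - 1 + ‖u k‖ ^ 2 / 6) * u k c with hR_def
  have hS : (∑ k, Real.sinc ‖u k‖ * u k c) = L - K / 6 + R := by
    rw [hL_def, hK_def, hR_def, Finset.sum_div, ← Finset.sum_sub_distrib, ← Finset.sum_add_distrib]
    exact Finset.sum_congr rfl fun k _ => by ring
  have hn : 0 ≤ n := Nat.cast_nonneg _
  have habs : ∀ k : κ, |u k c| ≤ ‖u k‖ := fun k => by simpa only [Real.norm_eq_abs] using PiLp.norm_apply_le (u k) c
  have hcard : ∀ f : κ → ℝ, ∀ b : ℝ, (∀ k, |f k| ≤ b) → |∑ k, f k| ≤ n * b := by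
    intro f b hf
    calc |∑ k, f k| ≤ ∑ k, |f k| := Finset.abs_sum_le_sum_abs _ _
      _ ≤ ∑ _k : κ, b := Finset.sum_le_sum fun k _ => hf k
      _ = n * b := by rw [Finset.sum_const, Finset.card_univ, nsmul_eq_mul, hn_def]
  have hL : |L| ≤ n * t := hcard _ _ fun k => (habs k).trans (hu k)
  have hK : |K| ≤ n * t ^ 3 := by
    refine hcard _ _ fun k => ?_
    rw [abs_mul, abs_of_nonneg (sq_nonneg _)]
    calc ‖u k‖ ^ 2 * |u k c| ≤ ‖u k‖ ^ 2 * ‖u k‖ := mul_le_mul_of_nonneg_left (habs k) (sq_nonneg _)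
      _ = ‖u k‖ ^ 3 := by ring
      _ ≤ t ^ 3 := pow_le_pow_left₀ (norm_nonneg _) (hu k) 3
  have hR : |R| ≤ n * (t ^ 5 / 100) := by
    refine hcard _ _ fun k => ?_
    rw [abs_mul]
    have h1 : ‖u k‖ ≤ 1 := (hu k).trans ht1
    have hρ := abs_sinc_taylor_four (norm_nonneg (u k)) h1
    calc |Real.sinc ‖u k‖ - 1 + ‖u k‖ ^ 2 / 6| * |u k c| ≤ ‖u k‖ ^ 4 / 100 * ‖u k‖ :=
          mul_le_mul hρ (habs k) (abs_nonneg _) (by positivity)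
      _ = ‖u k‖ ^ 5 / 100 := by ring
      _ ≤ t ^ 5 / 100 := by gcongr; exact hu k
  rw [hS]
  have e : (L - K / 6 + R) ^ 2 - L ^ 2 + 1 / 3 * L * K = 2 * L * R + (R - K / 6) ^ 2 := by ring
  rw [e]
  have ht5 : t ^ 5 ≤ t ^ 3 := pow_le_pow_of_le_one ht0 ht1 (by norm_num)
  have hRK : |R - K / 6| ≤ n * (t ^ 3 / 100) + n * t ^ 3 / 6 := by
    calc |R - K / 6| ≤ |R| + |K / 6| := abs_sub _ _
      _ = |R| + |K| / 6 := by rw [abs_div, abs_of_pos (by norm_num : (0:ℝ) < 6)]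
      _ ≤ n * (t ^ 5 / 100) + n * t ^ 3 / 6 := by gcongr
      _ ≤ n * (t ^ 3 / 100) + n * t ^ 3 / 6 := by gcongr
  calc |2 * L * R + (R - K / 6) ^ 2| ≤ |2 * L * R| + |(R - K / 6) ^ 2| := abs_add_le _ _
    _ = 2 * |L| * |R| + |R - K / 6| ^ 2 := by rw [abs_mul, abs_mul, abs_two, abs_pow]
    _ ≤ 2 * (n * t) * (n * (t ^ 5 / 100)) + (n * (t ^ 3 / 100) + n * t ^ 3 / 6) ^ 2 := by gcongr
    _ = n ^ 2 * (t * t ^ 5) / 50 + n ^ 2 * t ^ 6 * (53 / 300) ^ 2 := by ring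
    _ ≤ n ^ 2 * t ^ 6 := by
        have h6 : 0 ≤ n ^ 2 * t ^ 6 := by positivity
        have e6 : t * t ^ 5 = t ^ 6 := by ring
        rw [e6]
        nlinarith [h6]

end Generic

/-! ## The eight signed edge variables at an interior site -/

variable {H : ℕ}

/-- At an interior site, `g_x · (F ∘ a) = Σ_k F(u_k)` over the eight signed edge variables `u = (a_{in μ}, −a_{out μ})`, for odd `F`. -/
theorem gradVec_dotProduct_eq_sum_signed {x : Site 4} (hx : x ∈ interiorSites H) (a : LandauFree H → E3)
    (F : E3 → ℝ) (hF : ∀ v, F (-v) = -F v) :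
    (gradVec H x ⬝ᵥ fun e : LandauFree H => F (a e)) =
      ∑ k : Fin 4 ⊕ Fin 4, F (Sum.elim (fun μ => a (inEdge hx μ)) (fun μ => -a (outEdge hx μ)) k) := by
  rw [gradVec_dotProduct_eq_interior hx, Fintype.sum_sum_type]
  simp only [Sum.elim_inl, Sum.elim_inr, hF, Finset.sum_neg_distrib, sub_eq_add_neg]

/-- `|g_x e|` is the indicator of «`e` ends at `x`» plus the indicator of «`e` starts at `x`». -/
theorem abs_gradVec_eq (x : Site 4) (e : LandauFree H) :
    |gradVec H x e| = (if e.1.1.1 + Pi.single e.1.1.2 1 = x then (1 : ℝ) else 0) + (if e.1.1.1 = x then (1 : ℝ) else 0) := by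
  unfold gradVec
  by_cases h1 : e.1.1.1 + Pi.single e.1.1.2 1 = x
  · have h2 : ¬ e.1.1.1 = x := by
      intro h2
      have h3 := congrFun h1 e.1.1.2
      rw [h2, Pi.add_apply, Pi.single_eq_same] at h3
      omega
    simp only [if_pos h1, if_neg h2]; norm_num
  · by_cases h2 : e.1.1.1 = x
    · simp only [if_neg h1, if_pos h2]; norm_num
    · simp only [if_neg h1, if_neg h2]; norm_num

/-- At an interior site, `Σ_e |g_x e| f(e) = Σ_μ f(in μ) + Σ_μ f(out μ)`. -/
theorem sum_abs_gradVec_mul {x : Site 4} (hx : x ∈ interiorSites H) (f : LandauFree H → ℝ) :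
    ∑ e : LandauFree H, |gradVec H x e| * f e = ∑ μ : Fin 4, f (inEdge hx μ) + ∑ μ : Fin 4, f (outEdge hx μ) := by
  have h : ∀ e : LandauFree H, |gradVec H x e| * f e =
      (if e.1.1.1 + Pi.single e.1.1.2 1 = x then f e else 0) + (if e.1.1.1 = x then f e else 0) := by
    intro e
    rw [abs_gradVec_eq, add_mul, ite_mul, ite_mul, one_mul, zero_mul]
  simp only [h, Finset.sum_add_distrib, sum_ite_tip_eq hx, sum_ite_base_eq hx]

/-- The squared norms of the eight signed edge variables sum to `Σ_e |g_x e| ‖a_e‖²`. -/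
theorem sum_norm_sq_signed {x : Site 4} (hx : x ∈ interiorSites H) (a : LandauFree H → E3) :
    ∑ k : Fin 4 ⊕ Fin 4, ‖Sum.elim (fun μ => a (inEdge hx μ)) (fun μ => -a (outEdge hx μ)) k‖ ^ 2 =
      ∑ e : LandauFree H, |gradVec H x e| * ‖a e‖ ^ 2 := by
  rw [sum_abs_gradVec_mul hx, Fintype.sum_sum_type]
  simp only [Sum.elim_inl, Sum.elim_inr, norm_neg]

/-- The number of interior sites is at most `16 H⁴`. -/
theorem card_interiorSites_le (H : ℕ) : ((interiorSites H).card : ℝ) ≤ 16 * (H : ℝ) ^ 4 := by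
  have h : (interiorSites H).card ≤ (2 * H) ^ 4 := by
    rw [interiorSites, Fintype.card_piFinset_const, Int.card_Icc]
    apply Nat.pow_le_pow_left
    omega
  calc ((interiorSites H).card : ℝ) ≤ (((2 * H) ^ 4 : ℕ) : ℝ) := by exact_mod_cast h
    _ = 16 * (H : ℝ) ^ 4 := by push_cast; ring

/-! ## Per-site bounds for the chart field -/

/-- **Per-site quartic bound** (any field, no smallness). -/
theorem site_quartic {x : Site 4} (hx : x ∈ interiorSites H) (a : LandauFree H → E3) :
    |∑ c : Fin 3, ((gradVec H x ⬝ᵥ fun e : LandauFree H => Real.sinc ‖a e‖ * a e c) ^ 2 - divLin H x a c ^ 2)| ≤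
      8 * (∑ e : LandauFree H, |gradVec H x e| * ‖a e‖ ^ 2) ^ 2 := by
  have hF1 : ∀ c : Fin 3, ∀ v : E3, Real.sinc ‖-v‖ * (-v) c = -(Real.sinc ‖v‖ * v c) := fun c v => by simp [norm_neg]
  have hF2 : ∀ c : Fin 3, ∀ v : E3, (-v) c = -(v c) := fun c v => by simp
  have h1 : ∀ c : Fin 3, (gradVec H x ⬝ᵥ fun e : LandauFree H => Real.sinc ‖a e‖ * a e c) =
      ∑ k : Fin 4 ⊕ Fin 4, Real.sinc ‖Sum.elim (fun μ => a (inEdge hx μ)) (fun μ => -a (outEdge hx μ)) k‖ *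
        Sum.elim (fun μ => a (inEdge hx μ)) (fun μ => -a (outEdge hx μ)) k c :=
    fun c => gradVec_dotProduct_eq_sum_signed hx a (fun v => Real.sinc ‖v‖ * v c) (hF1 c)
  have h2 : ∀ c : Fin 3, divLin H x a c =
      ∑ k : Fin 4 ⊕ Fin 4, Sum.elim (fun μ => a (inEdge hx μ)) (fun μ => -a (outEdge hx μ)) k c :=
    fun c => gradVec_dotProduct_eq_sum_signed hx a (fun v => v c) (hF2 c)
  simp only [h1, h2]
  refine (quartic_site _).trans ?_
  rw [sum_norm_sq_signed hx a]
  simp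

/-- **Per-site sextic bound** (all `‖a_e‖ ≤ t ≤ 1`). -/
theorem site_sextic {x : Site 4} (hx : x ∈ interiorSites H) (a : LandauFree H → E3) {t : ℝ} (ht0 : 0 ≤ t) (ht1 : t ≤ 1)
    (hat : ∀ e, ‖a e‖ ≤ t) :
    |∑ c : Fin 3, ((gradVec H x ⬝ᵥ fun e : LandauFree H => Real.sinc ‖a e‖ * a e c) ^ 2 - divLin H x a c ^ 2 +
        1 / 3 * divLin H x a c * divLin H x (cubeField a) c)| ≤ 192 * t ^ 6 := by
  have hF1 : ∀ c : Fin 3, ∀ v : E3, Real.sinc ‖-v‖ * (-v) c = -(Real.sinc ‖v‖ * v c) := fun c v => by simp [norm_neg]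
  have hF2 : ∀ c : Fin 3, ∀ v : E3, (-v) c = -(v c) := fun c v => by simp
  have hF3 : ∀ c : Fin 3, ∀ v : E3, ‖-v‖ ^ 2 * (-v) c = -(‖v‖ ^ 2 * v c) := fun c v => by simp [norm_neg]
  have h1 : ∀ c : Fin 3, (gradVec H x ⬝ᵥ fun e : LandauFree H => Real.sinc ‖a e‖ * a e c) =
      ∑ k : Fin 4 ⊕ Fin 4, Real.sinc ‖Sum.elim (fun μ => a (inEdge hx μ)) (fun μ => -a (outEdge hx μ)) k‖ *
        Sum.elim (fun μ => a (inEdge hx μ)) (fun μ => -a (outEdge hx μ)) k c :=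
    fun c => gradVec_dotProduct_eq_sum_signed hx a (fun v => Real.sinc ‖v‖ * v c) (hF1 c)
  have h2 : ∀ c : Fin 3, divLin H x a c =
      ∑ k : Fin 4 ⊕ Fin 4, Sum.elim (fun μ => a (inEdge hx μ)) (fun μ => -a (outEdge hx μ)) k c :=
    fun c => gradVec_dotProduct_eq_sum_signed hx a (fun v => v c) (hF2 c)
  have h3 : ∀ c : Fin 3, divLin H x (cubeField a) c =
      ∑ k : Fin 4 ⊕ Fin 4, ‖Sum.elim (fun μ => a (inEdge hx μ)) (fun μ => -a (outEdge hx μ)) k‖ ^ 2 *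
        Sum.elim (fun μ => a (inEdge hx μ)) (fun μ => -a (outEdge hx μ)) k c := by
    intro c
    have e : divLin H x (cubeField a) c = gradVec H x ⬝ᵥ fun e : LandauFree H => ‖a e‖ ^ 2 * a e c := by
      unfold divLin
      congr 1
    rw [e]
    exact gradVec_dotProduct_eq_sum_signed hx a (fun v => ‖v‖ ^ 2 * v c) (hF3 c)
  have hu : ∀ k : Fin 4 ⊕ Fin 4, ‖Sum.elim (fun μ => a (inEdge hx μ)) (fun μ => -a (outEdge hx μ)) k‖ ≤ t := by
    rintro (μ | μ)
    · exact hat _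
    · simp only [Sum.elim_inr, norm_neg]; exact hat _
  simp only [h1, h2, h3]
  calc _ ≤ ∑ c : Fin 3, |_| := Finset.abs_sum_le_sum_abs _ _
    _ ≤ ∑ _c : Fin 3, (Fintype.card (Fin 4 ⊕ Fin 4) : ℝ) ^ 2 * t ^ 6 :=
        Finset.sum_le_sum fun c _ => sextic_core _ c ht0 ht1 hu
    _ = 192 * t ^ 6 := by simp; ring

end PhiTaylorProof

open PhiTaylorProof in
/-- **T-S5.7b `PhiTaylor`, BY NAME** (constant `C = 3072`): in the edge chart the gauge-fixing functional `Φ` is EVEN (`Φ(U(−a)) = Φ(U(a))`),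
satisfies the GLOBAL quartic bound `|Φ(U(a)) − Σ_x|(d*a)_x|²| ≤ C Σ_x (Σ_{e∋x} ‖a_e‖²)²` with no smallness, and equals its quadratic part plus
`phiQuartic` up to `C·H⁴·t⁶` when all `‖a_e‖ ≤ t ≤ 1`. -/
theorem phiTaylor : PhiTaylor := by
  refine ⟨3072, fun H _ a => ⟨landauPhi_edgeChart_neg H a, ?_, fun t ht0 ht1 hat => ?_⟩⟩
  · have hdiff : landauPhi H (edgeChart H a) - divLinSq H a =
        ∑ x ∈ interiorSites H, ∑ c : Fin 3,
          ((gradVec H x ⬝ᵥ fun e : LandauFree H => Real.sinc ‖a e‖ * a e c) ^ 2 - divLin H x a c ^ 2) := by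
      rw [landauPhi_edgeChart_eq, divLinSq, ← Finset.sum_sub_distrib]
      exact Finset.sum_congr rfl fun x _ => by rw [← Finset.sum_sub_distrib]
    rw [hdiff]
    have hnn : 0 ≤ ∑ x ∈ interiorSites H, (∑ e : LandauFree H, |gradVec H x e| * ‖a e‖ ^ 2) ^ 2 :=
      Finset.sum_nonneg fun x _ => sq_nonneg _
    calc _ ≤ ∑ x ∈ interiorSites H, |∑ c : Fin 3,
            ((gradVec H x ⬝ᵥ fun e : LandauFree H => Real.sinc ‖a e‖ * a e c) ^ 2 - divLin H x a c ^ 2)| :=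
          Finset.abs_sum_le_sum_abs _ _
      _ ≤ ∑ x ∈ interiorSites H, 8 * (∑ e : LandauFree H, |gradVec H x e| * ‖a e‖ ^ 2) ^ 2 :=
          Finset.sum_le_sum fun x hx => site_quartic hx a
      _ = 8 * ∑ x ∈ interiorSites H, (∑ e : LandauFree H, |gradVec H x e| * ‖a e‖ ^ 2) ^ 2 := by rw [Finset.mul_sum]
      _ ≤ 3072 * ∑ x ∈ interiorSites H, (∑ e : LandauFree H, |gradVec H x e| * ‖a e‖ ^ 2) ^ 2 := by nlinarith
  · have hdiff : landauPhi H (edgeChart H a) - divLinSq H a - phiQuartic H a =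
        ∑ x ∈ interiorSites H, ∑ c : Fin 3,
          ((gradVec H x ⬝ᵥ fun e : LandauFree H => Real.sinc ‖a e‖ * a e c) ^ 2 - divLin H x a c ^ 2 +
            1 / 3 * divLin H x a c * divLin H x (cubeField a) c) := by
      rw [landauPhi_edgeChart_eq, divLinSq, phiQuartic, neg_mul, sub_neg_eq_add, Finset.mul_sum, ← Finset.sum_sub_distrib,
        ← Finset.sum_add_distrib]
      refine Finset.sum_congr rfl fun x _ => ?_
      rw [Finset.mul_sum, ← Finset.sum_sub_distrib, ← Finset.sum_add_distrib]
      exact Finset.sum_congr rfl fun c _ => by ring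
    rw [hdiff]
    have hH4 : 0 ≤ (H : ℝ) ^ 4 := by positivity
    have ht6 : 0 ≤ t ^ 6 := by positivity
    calc _ ≤ ∑ x ∈ interiorSites H, |∑ c : Fin 3,
            ((gradVec H x ⬝ᵥ fun e : LandauFree H => Real.sinc ‖a e‖ * a e c) ^ 2 - divLin H x a c ^ 2 +
              1 / 3 * divLin H x a c * divLin H x (cubeField a) c)| := Finset.abs_sum_le_sum_abs _ _
      _ ≤ ∑ _x ∈ interiorSites H, 192 * t ^ 6 := Finset.sum_le_sum fun x hx => site_sextic hx a ht0 ht1 hat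
      _ = (interiorSites H).card * (192 * t ^ 6) := by rw [Finset.sum_const, nsmul_eq_mul]
      _ ≤ 16 * (H : ℝ) ^ 4 * (192 * t ^ 6) := mul_le_mul_of_nonneg_right (card_interiorSites_le H) (by positivity)
      _ = 3072 * (H : ℝ) ^ 4 * t ^ 6 := by ring

end Summit.QuantumFields.YangMills.Theorems.AllWindowsColdBoxBoxHighLine

end
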